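import Literature.AlgebraicGeometry.HodgeTheory.HodgeSheafWedge
import Literature.AlgebraicGeometry.Modules.LocalFrames
import Mathlib.Topology.Sheaves.LocallySurjective
import Mathlib.CategoryTheory.Sites.LocallyInjective
import Mathlib.Topology.Sheaves.SheafCondition.UniqueGluing
import HarnessLib

/-!
# The wedge on the Hodge sheaves is alternating: `θ ∧ θ ∧ s = 0`, `θ ∧ θ' ∧ s = -θ' ∧ θ ∧ s`

For a commutative ring `S` and an `S`-scheme `X : Over (Spec S)`, `HodgeTheory/HodgeSheafWedge.lean` constructs the
left wedge `∧ : Ωʲ → 𝓗om(Ω¹, Ωʲ⁺¹)` on the Hodge SHEAVES `Ωʲ_{X/S} = ⋀ʲ Ω¹_{X/S}` (`Motives.hodgeSheaf X j`, the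
sheafification of `U ↦ ⋀ʲ_{𝒪(U)} Γ(U, Ω¹)`) from the module-level wedge `wedgeLeftHom`, which is alternating
(`wedgeLeftHom_wedgeLeftHom : θ ∧ θ ∧ x = 0`). This file transports the alternating law to the sheaf:

* `wedgeAt θ s = θ ∧ s ∈ Γ(Ωʲ⁺¹, W)` for SHEAF sections `s ∈ Γ(Ωʲ, W)`, `θ ∈ Γ(Ω¹, W)`; bilinear, compatible
  with restriction (`map_wedgeAt`), and on (images of) presheaf forms the module wedge (`wedgeAt_toHodgeSheaf`);
* **`wedgeAt_wedgeAt_self : θ ∧ (θ ∧ s) = 0`** — proof: the sheafification map `⋀ʲ Γ(–, Ω¹) → Ωʲ` is locally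
  surjective (Mathlib `Presheaf.isLocallySurjective_toSheafify`), so locally `s` is a form, where the identity is the
  module-level one; and `Ωʲ⁺²` is a sheaf (Mathlib `TopCat.Sheaf.eq_of_locally_eq'`);
* by polarisation **`wedgeAt_wedgeAt_add : θ ∧ (θ' ∧ s) + θ' ∧ (θ ∧ s) = 0`** and `wedgeAt_comm`;
* the same as identities of morphisms of restricted modules: `wedgeForm θ : Ωʲ|_V → Ωʲ⁺¹|_V` (`s ↦ θ| ∧ s`; it is
  the map through which the twisting term `da ∧ –` of the `Ωʲ`-twisted jet sequences
  `HodgeTheory/SemiregularityHigherSigma.wedgeD` factors, definitionally), `wedgeForm_comp_wedgeForm_self`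
  (`(θ ∧ –) ≫ (θ ∧ –) = 0`), **`wedgeForm_comp_wedgeForm_comm`** (`(θ ∧ –) ≫ (θ' ∧ –) = -((θ' ∧ –) ≫ (θ ∧ –))`).

This is the graded commutativity `dx^α ∧ dx^β = -dx^β ∧ dx^α` of differential forms [Kodaira2005, §3.1 (b)] for the
sheaf exterior algebra `⋀ Ω¹` [Hartshorne1977, II Ex. 5.16], in the two degrees (`1` and `j`) the tree uses; it is
the input for the (super)commutation of the Atiyah steps with scalar `1`-form classes (Buchweitz–Flenner's
"`1 ⊗ c` is central in the algebra `A`"). Everything is proved; no named facts.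

## References

* K. Kodaira, *Complex Manifolds and Deformation of Complex Structures* (2005), §3.1 (b) (p. 80:
  `dx^α ∧ dx^β = -dx^β ∧ dx^α`). [Kodaira2005]
* R. Hartshorne, *Algebraic Geometry* (1977), II Ex. 5.16 (exterior algebra of a sheaf of modules, by
  sheafification), II Prop. 1.1 / Ex. 1.2 (locality). [Hartshorne1977]
-/

set_option backward.isDefEq.respectTransparency false

noncomputable section

universe u

open CategoryTheory AlgebraicGeometry Opposite TopologicalSpace Limits

namespace Literature.AlgebraicGeometry.HodgeTheory

open Literature.AlgebraicGeometry.Modules Literature.AlgebraicGeometry.Motives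

variable {S : Type u} [CommRing S] {X : Over (Spec (CommRingCat.of S))} {j : ℕ} {U V W : X.left.Opens}

/-! ### `θ ∧ s` for sheaf sections -/

section WedgeAt

variable (j) in
/-- **`θ ∧ s ∈ Γ(Ωʲ⁺¹, W)`** for a section `s ∈ Γ(Ωʲ, W)` of the Hodge SHEAF and a `1`-form `θ ∈ Γ(Ω¹, W)`: the value
at `θ` of `∧(s) : Ω¹|_W → Ωʲ⁺¹|_W` (`wedgeSheafHom`). [cite: Hartshorne1977, II Ex. 5.16] -/
def wedgeAt (θ : Γ(cotangentSheaf X, W)) (s : Γ(hodgeSheaf X j, W)) : Γ(hodgeSheaf X (j + 1), W) :=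
  appLE (((wedgeSheafHom X j).app W s :
    (cotangentSheaf X).over W ⟶ (hodgeSheaf X (j + 1)).over W)) (𝟙 W) θ

/-- `θ ∧ s` is additive in `s`. [cite: Kodaira2005, §3.1 (b)] -/
lemma wedgeAt_add_right (θ : Γ(cotangentSheaf X, W)) (s t : Γ(hodgeSheaf X j, W)) :
    wedgeAt j θ (s + t) = wedgeAt j θ s + wedgeAt j θ t := by
  rw [wedgeAt, wedgeAt, wedgeAt, map_add]
  exact appLE_add _ _ _ _

/-- `θ ∧ s` is `𝒪(W)`-linear in `s`. [cite: Kodaira2005, §3.1 (b)] -/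
lemma wedgeAt_smul_right (θ : Γ(cotangentSheaf X, W)) (a : Γ(X.left, W)) (s : Γ(hodgeSheaf X j, W)) :
    wedgeAt j θ (a • s) = a • wedgeAt j θ s := by
  rw [wedgeAt, wedgeAt, Scheme.Modules.Hom.app_smul]
  exact appLE_smul_id _ _ _

/-- `θ ∧ s` is additive in `θ`. [cite: Kodaira2005, §3.1 (b)] -/
lemma wedgeAt_add_left (θ θ' : Γ(cotangentSheaf X, W)) (s : Γ(hodgeSheaf X j, W)) :
    wedgeAt j (θ + θ') s = wedgeAt j θ s + wedgeAt j θ' s :=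
  appLE_add_right _ _ _ _

/-- `θ ∧ s` is `𝒪(W)`-linear in `θ`. [cite: Kodaira2005, §3.1 (b)] -/
lemma wedgeAt_smul_left (a : Γ(X.left, W)) (θ : Γ(cotangentSheaf X, W)) (s : Γ(hodgeSheaf X j, W)) :
    wedgeAt j (a • θ) s = a • wedgeAt j θ s :=
  appLE_smul_right _ _ _ _

/-- `θ ∧ 0 = 0`. [cite: Kodaira2005, §3.1 (b)] -/
@[simp] lemma wedgeAt_zero_right (θ : Γ(cotangentSheaf X, W)) : wedgeAt j θ (0 : Γ(hodgeSheaf X j, W)) = 0 := by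
  rw [wedgeAt, map_zero]
  rfl

/-- **`θ ∧ s` commutes with restriction**: `(θ ∧ s)|_V = θ|_V ∧ s|_V`. [cite: Hartshorne1977, II Ex. 5.16] -/
lemma map_wedgeAt (l : V ⟶ W) (θ : Γ(cotangentSheaf X, W)) (s : Γ(hodgeSheaf X j, W)) :
    (hodgeSheaf X (j + 1)).presheaf.map l.op (wedgeAt j θ s) =
      wedgeAt j ((cotangentSheaf X).presheaf.map l.op θ) ((hodgeSheaf X j).presheaf.map l.op s) := by
  rw [wedgeAt, wedgeAt, Scheme.Modules.Hom.app_map_apply, ← appLE_map, Category.comp_id]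
  change _ = appLE (restrictHom l ((wedgeSheafHom X j).app W s)) (𝟙 V) _
  rw [appLE_restrictHom, Category.id_comp]

/-- **On forms the sheaf wedge is the module wedge**: for `ω ∈ ⋀ʲ Γ(W, Ω¹)`,
`θ ∧ ω^♯ = (θ ∧ ω)^♯` (`^♯ = toHodgeSheaf`). [cite: Hartshorne1977, II Ex. 5.16] -/
lemma wedgeAt_toHodgeSheaf (θ : Γ(cotangentSheaf X, W)) (ω : (formsPresheaf X j).obj (op W)) :
    wedgeAt j θ ((toHodgeSheaf X j).app (op W) ω) =
      (toHodgeSheaf X (j + 1)).app (op W) (wedgeLeftHom ((formsOne X).obj (op W)) j θ ω) := by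
  rw [wedgeAt]
  change appLE ((wedgeSheafHom X j).val.app (op W) ((toHodgeSheaf X j).app (op W) ω)) (𝟙 W) θ = _
  rw [wedgeSheafHom_app_toHodgeSheaf, appLE_wedgeHom, wedgeSection, op_id, (formsPresheaf X j).map_id]
  rfl

/-- **The sheaf wedge is alternating**: `θ ∧ (θ ∧ s) = 0` for every section `s` of `Ωʲ` (locally `s` is a form,
where this is `wedgeLeftHom_wedgeLeftHom`; `Ωʲ⁺²` is a sheaf). [cite: Kodaira2005, §3.1 (b)]
[cite: Hartshorne1977, II Ex. 5.16] -/
theorem wedgeAt_wedgeAt_self (θ : Γ(cotangentSheaf X, W)) (s : Γ(hodgeSheaf X j, W)) :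
    wedgeAt (j + 1) θ (wedgeAt j θ s) = 0 := by
  -- the sheafification map is locally surjective
  have hsurj : TopCat.Presheaf.IsLocallySurjective
      (toSheafify (Opens.grothendieckTopology X.left) (formsPresheaf X j).presheaf) :=
    (inferInstance : Presheaf.IsLocallySurjective (Opens.grothendieckTopology X.left)
      (toSheafify (Opens.grothendieckTopology X.left) (formsPresheaf X j).presheaf))
  have key : ∀ x : W, ∃ V : X.left.Opens, (x : X.left) ∈ V ∧ ∃ i : V ≤ W,
      (hodgeSheaf X (j + 1 + 1)).presheaf.map (homOfLE i).op (wedgeAt (j + 1) θ (wedgeAt j θ s)) = 0 := by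
    rintro ⟨x, hx⟩
    obtain ⟨V, hVW, ⟨ω, hω⟩, hxV⟩ := (TopCat.Presheaf.isLocallySurjective_iff _).1 hsurj W s x hx
    refine ⟨V, hxV, hVW, ?_⟩
    have hω' : (toHodgeSheaf X j).app (op V) ω = (hodgeSheaf X j).presheaf.map (homOfLE hVW).op s := hω
    rw [map_wedgeAt, map_wedgeAt, ← hω', wedgeAt_toHodgeSheaf, wedgeAt_toHodgeSheaf, wedgeLeftHom_wedgeLeftHom,
      map_zero]
  choose V' hxV hVW hV0 using key
  exact TopCat.Sheaf.eq_of_locally_eq' (SheafOfModules.toSheaf _ |>.obj (hodgeSheaf X (j + 1 + 1))) V' W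
    (fun x => homOfLE (hVW x)) (fun x hx => Opens.mem_iSup.2 ⟨⟨x, hx⟩, hxV ⟨x, hx⟩⟩) _ 0 fun x => by
      rw [map_zero]; exact hV0 x

/-- **Polarisation**: `θ ∧ (θ' ∧ s) + θ' ∧ (θ ∧ s) = 0`. [cite: Kodaira2005, §3.1 (b)] -/
theorem wedgeAt_wedgeAt_add (θ θ' : Γ(cotangentSheaf X, W)) (s : Γ(hodgeSheaf X j, W)) :
    wedgeAt (j + 1) θ (wedgeAt j θ' s) + wedgeAt (j + 1) θ' (wedgeAt j θ s) = 0 := by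
  have h := wedgeAt_wedgeAt_self (j := j) (θ + θ') s
  rw [wedgeAt_add_left (j := j) θ θ' s, wedgeAt_add_right, wedgeAt_add_left, wedgeAt_add_left,
    wedgeAt_wedgeAt_self, wedgeAt_wedgeAt_self, zero_add, add_zero] at h
  exact (add_comm _ _).trans h

/-- **Anticommutation**: `θ ∧ (θ' ∧ s) = -(θ' ∧ (θ ∧ s))` (`dx^α ∧ dx^β = -dx^β ∧ dx^α`).
[cite: Kodaira2005, §3.1 (b)] -/
theorem wedgeAt_comm (θ θ' : Γ(cotangentSheaf X, W)) (s : Γ(hodgeSheaf X j, W)) :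
    wedgeAt (j + 1) θ (wedgeAt j θ' s) = -wedgeAt (j + 1) θ' (wedgeAt j θ s) :=
  eq_neg_of_add_eq_zero_left (wedgeAt_wedgeAt_add θ θ' s)

end WedgeAt

/-! ### `θ ∧ –` as a morphism of restricted modules -/

section WedgeForm

variable (j) in
/-- **`θ ∧ – : Ωʲ|_V → Ωʲ⁺¹|_V`** for `θ ∈ Γ(Ω¹, V)`: the sheaf wedge followed by evaluation at `θ`; the twisting
term `da ∧ –` of the `Ωʲ`-twisted jet sequence (`SemiregularityHigherSigma.wedgeD E j V a φ`) is `φ ≫ wedgeForm j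
(dSection a)`, definitionally. [cite: Hartshorne1977, II Ex. 5.16] -/
def wedgeForm (θ : Γ(cotangentSheaf X, V)) : (hodgeSheaf X j).over V ⟶ (hodgeSheaf X (j + 1)).over V :=
  (SheafOfModules.overFunctor _ V).map (wedgeSheafHom X j) ≫ evalAt (M := hodgeSheaf X (j + 1)) θ

/-- Values of `θ ∧ –`: `s ↦ θ|_W ∧ s`. [cite: Hartshorne1977, II Ex. 5.16] -/
@[simp]
lemma appLE_wedgeForm (θ : Γ(cotangentSheaf X, V)) (k : W ⟶ V) (s : Γ(hodgeSheaf X j, W)) :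
    appLE (wedgeForm j θ) k s = wedgeAt j ((cotangentSheaf X).presheaf.map k.op θ) s := by
  rw [wedgeForm, appLE_comp, appLE_over_map]
  rfl

/-- `θ ∧ –` is additive in `θ`. [cite: Kodaira2005, §3.1 (b)] -/
lemma wedgeForm_add (θ θ' : Γ(cotangentSheaf X, V)) : wedgeForm j (θ + θ') = wedgeForm j θ + wedgeForm j θ' := by
  rw [wedgeForm, wedgeForm, wedgeForm, evalAt_add, Preadditive.comp_add]

/-- `θ ∧ –` is `𝒪(V)`-linear in `θ`. [cite: Kodaira2005, §3.1 (b)] -/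
lemma wedgeForm_smul (a : Γ(X.left, V)) (θ : Γ(cotangentSheaf X, V)) : wedgeForm j (a • θ) = a • wedgeForm j θ := by
  rw [wedgeForm, wedgeForm, evalAt_smul, smul_overHom_def, smul_overHom_def, Category.assoc]

/-- `θ ∧ –` restricts to `θ|_W ∧ –`. [cite: Hartshorne1977, II Ex. 5.16] -/
lemma restrictHom_wedgeForm (k : W ⟶ V) (θ : Γ(cotangentSheaf X, V)) :
    restrictHom k (wedgeForm j θ) = wedgeForm j ((cotangentSheaf X).presheaf.map k.op θ) := by
  refine hom_ext_of_appLE fun W' l s => ?_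
  rw [appLE_restrictHom, appLE_wedgeForm, appLE_wedgeForm, op_comp, (cotangentSheaf X).presheaf.map_comp]
  rfl

/-- **`(θ ∧ –) ≫ (θ ∧ –) = 0`.** [cite: Kodaira2005, §3.1 (b)] -/
theorem wedgeForm_comp_wedgeForm_self (θ : Γ(cotangentSheaf X, V)) :
    wedgeForm j θ ≫ wedgeForm (j + 1) θ = 0 := by
  refine hom_ext_of_appLE fun W k s => ?_
  rw [appLE_comp, appLE_wedgeForm, appLE_wedgeForm, wedgeAt_wedgeAt_self]
  rfl

/-- **`(θ ∧ –) ≫ (θ' ∧ –) = -((θ' ∧ –) ≫ (θ ∧ –))`**: graded commutativity of `1`-forms acting on `Ωʲ`.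
[cite: Kodaira2005, §3.1 (b)] -/
theorem wedgeForm_comp_wedgeForm_comm (θ θ' : Γ(cotangentSheaf X, V)) :
    wedgeForm j θ ≫ wedgeForm (j + 1) θ' = -(wedgeForm j θ' ≫ wedgeForm (j + 1) θ) := by
  refine hom_ext_of_appLE fun W k s => ?_
  rw [appLE_comp, appLE_wedgeForm, appLE_wedgeForm, wedgeAt_comm]
  rw [show appLE (-(wedgeForm j θ' ≫ wedgeForm (j + 1) θ)) k s = -appLE (wedgeForm j θ' ≫ wedgeForm (j + 1) θ) k s
    from map_neg (appLEHom k s) _, appLE_comp, appLE_wedgeForm, appLE_wedgeForm]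

end WedgeForm

end Literature.AlgebraicGeometry.HodgeTheory

end
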